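import Literature.MathematicalPhysics.QuantumManyBody.BoseGasThermodynamicLimitRuelle
import Summits.AtomisticToContinuum.BoseEinsteinCondensation.Theorems.BECInfDivCoherenceGridInfDivCoherenceFreeRegionMaximiser
import Summits.AtomisticToContinuum.BoseEinsteinCondensation.Theorems.BECInfDivCoherenceGridInfDivCoherenceFreeRegionLatticeMatching
import Mathlib.Topology.Connected.PathConnected
import HarnessLib

/-!
# Crux `GridInfDivCoherence` (stmt-AtomisticToContinuum-9114), line `registered`: the composition step of the
# dilute hard-sphere connectivity statement G — component maximiser (A), lattice retraction (D1), lattice matching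
# (D2) and the sparse-maximiser floor imply G

The free region of `N` hard spheres with exclusion distance `b` on the torus `ℝ³/Lℤ³`, written on `(ℝ³)^N` with all
lattice images, is `F = {X | ∀ i ≠ j, ∀ n ∈ ℤ³, b < ‖X i - X j - L n‖}`. Statement G says: in the dilute regime
(`ρ < ρ₁(b)`, `N` large, `L = sideLength ρ N`) any two configurations of `F` are joined inside `F` up to a relabelling
of the particles. `lemmaGConnected_of_maximiserFloor` (the registered signature) derives G from four hypotheses:

* (A) every `X ∈ F` is joined inside `F` to a maximiser `Z` of the minimal image pair distance over the path
  component of `X` (landed: `freeRegion_exists_joined_maximiser`);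
* (D1) a configuration with all image pair distances `≥ 4L/M` is joined inside `F` (`2bM < L`) to a configuration on
  the lattice `(L/M)ℤ³` with all image pair distances `≥ L/M` (landed: `freeRegion_joined_latticeConfig`);
* (D2) any two such lattice configurations are joined inside `F` up to a relabelling
  (landed: `freeRegion_latticeConfigs_joined`);
* (FLOOR) in the dilute regime there is a mesh `M` with `2bM < L` such that every maximiser `Z ∈ F` (maximal over its
  own path component) has all image pair distances `≥ 4L/M`.

Proof: for `X, Y ∈ F` take maximisers `Z_X, Z_Y` by (A); a configuration joined to `Z_X` is joined to `X`
(`JoinedIn.trans`), so `Z_X` is maximal over its own component and (FLOOR) applies; (D1) gives lattice configurations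
`T_X, T_Y` joined to `Z_X, Z_Y`; (D2) gives `σ` with `T_X ~ T_Y ∘ σ`. Relabelling by `σ` preserves `F` and is
continuous, so it transports `Y ~ Z_Y ~ T_Y` to `Y ∘ σ ~ T_Y ∘ σ`; chaining, `X ~ Y ∘ σ`. We also need `L > 0`
eventually (`tendsto_sideLength_atTop`) to feed (A). The corollary `lemmaGConnected_of_maximiserFloor'` discharges
(A), (D1), (D2) with the landed sub-goals, leaving only (FLOOR) as a hypothesis.

References: folklore (configuration spaces of hard spheres, e.g. Baryshnikov–Bubenik–Kahle, IMRN 2014, §2);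
Mathlib's `JoinedIn.map`, `JoinedIn.mono`, `Pi.continuous_precomp`.
-/

noncomputable section

namespace Summit.AtomisticToContinuum.BoseEinsteinCondensation.Theorems

open Filter Literature.MathematicalPhysics.QuantumManyBody Literature.MathematicalPhysics.QuantumManyBody.BoseGas

namespace LemmaGFloor

variable {N : ℕ} {L : ℝ}

/-- The free region is invariant under relabelling of the particles: for `i ≠ j` also `σ i ≠ σ j`, so the defining
inequalities of `W ∘ σ` are instances of those of `W`. [folklore] -/
theorem comp_perm_mem {b : ℝ} (σ : Equiv.Perm (Fin N)) {W : Config N}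
    (hW : W ∈ {X : Config N | ∀ i j : Fin N, i ≠ j → ∀ n : Fin 3 → ℤ, b < ‖X i - X j - latticeVec L n‖}) :
    (W ∘ σ) ∈ {X : Config N | ∀ i j : Fin N, i ≠ j → ∀ n : Fin 3 → ℤ, b < ‖X i - X j - latticeVec L n‖} :=
  fun i j hij n => hW (σ i) (σ j) (fun h => hij (σ.injective h)) n

/-- Relabelling of the particles transports joinability inside the free region: `(· ∘ σ)` is continuous and
preserves the free region. [folklore] -/
theorem joinedIn_comp_perm {b : ℝ} (σ : Equiv.Perm (Fin N)) {x y : Config N}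
    (h : JoinedIn {X : Config N | ∀ i j : Fin N, i ≠ j → ∀ n : Fin 3 → ℤ, b < ‖X i - X j - latticeVec L n‖} x y) :
    JoinedIn {X : Config N | ∀ i j : Fin N, i ≠ j → ∀ n : Fin 3 → ℤ, b < ‖X i - X j - latticeVec L n‖}
      (x ∘ σ) (y ∘ σ) := by
  refine (h.map (f := fun W : Config N => W ∘ σ) (Pi.continuous_precomp σ)).mono ?_
  rintro _ ⟨W, hW, rfl⟩
  exact comp_perm_mem σ hW

end LemmaGFloor

/-- **Composition step of the dilute hard-sphere connectivity statement G** (crux `GridInfDivCoherence`, line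
`registered`): the component maximiser (A), the lattice retraction (D1), the lattice matching (D2) and the
sparse-maximiser floor (in the dilute regime every maximiser of the minimal image pair distance over its path
component of the free region `F = {X | ∀ i ≠ j, ∀ n ∈ ℤ³, b < ‖X i - X j - L n‖}`, `L = sideLength ρ N`, has all image
pair distances `≥ 4L/M` for a mesh `M` with `2bM < L`) imply G: for `ρ < ρ₁(b)` and all large `N`, any two
configurations of `F` are joined inside `F` up to a relabelling of the particles. Chain
`X ~ Z_X ~ T_X ~ T_Y ∘ σ ~ Z_Y ∘ σ ~ Y ∘ σ`, the last two links being the relabelled path `Y ~ Z_Y ~ T_Y`. [folklore] -/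
theorem lemmaGConnected_of_maximiserFloor :
    (∀ (N : ℕ) (L b : ℝ), 0 < L →
      ∀ X ∈ {X : Config N | ∀ i j : Fin N, i ≠ j → ∀ n : Fin 3 → ℤ, b < ‖X i - X j - latticeVec L n‖},
        ∃ Z ∈ {X : Config N | ∀ i j : Fin N, i ≠ j → ∀ n : Fin 3 → ℤ, b < ‖X i - X j - latticeVec L n‖},
          JoinedIn {X : Config N | ∀ i j : Fin N, i ≠ j → ∀ n : Fin 3 → ℤ, b < ‖X i - X j - latticeVec L n‖} X Z ∧
          ∀ Y : Config N,
            JoinedIn {X : Config N | ∀ i j : Fin N, i ≠ j → ∀ n : Fin 3 → ℤ, b < ‖X i - X j - latticeVec L n‖} X Y →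
            ∀ d : ℝ, (∀ i j : Fin N, i ≠ j → ∀ n : Fin 3 → ℤ, d ≤ ‖Y i - Y j - latticeVec L n‖) →
              ∀ i j : Fin N, i ≠ j → ∀ n : Fin 3 → ℤ, d ≤ ‖Z i - Z j - latticeVec L n‖) →
    (∀ (N M : ℕ) (L b : ℝ), 0 < M → 0 < b → 2 * b * M < L →
      ∀ X : Config N, (∀ i j : Fin N, i ≠ j → ∀ n : Fin 3 → ℤ, 4 * (L / M) ≤ ‖X i - X j - latticeVec L n‖) →
        ∃ T : Config N, (∀ i, ∃ z : Fin 3 → ℤ, T i = latticeVec (L / M) z) ∧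
          (∀ i j : Fin N, i ≠ j → ∀ n : Fin 3 → ℤ, L / M ≤ ‖T i - T j - latticeVec L n‖) ∧
          JoinedIn {X : Config N | ∀ i j : Fin N, i ≠ j → ∀ n : Fin 3 → ℤ, b < ‖X i - X j - latticeVec L n‖} X T) →
    (∀ (N M : ℕ) (L b : ℝ), 0 < M → 0 < b → 2 * b * M < L →
      ∀ T T' : Config N, (∀ i, ∃ z : Fin 3 → ℤ, T i = latticeVec (L / M) z) →
        (∀ i j : Fin N, i ≠ j → ∀ n : Fin 3 → ℤ, L / M ≤ ‖T i - T j - latticeVec L n‖) →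
        (∀ i, ∃ z : Fin 3 → ℤ, T' i = latticeVec (L / M) z) →
        (∀ i j : Fin N, i ≠ j → ∀ n : Fin 3 → ℤ, L / M ≤ ‖T' i - T' j - latticeVec L n‖) →
        ∃ σ : Equiv.Perm (Fin N),
          JoinedIn {X : Config N | ∀ i j : Fin N, i ≠ j → ∀ n : Fin 3 → ℤ, b < ‖X i - X j - latticeVec L n‖}
            T (T' ∘ σ)) →
    (∀ b : ℝ, 0 < b → ∃ ρ₁ : ℝ, 0 < ρ₁ ∧ ∀ ρ : ℝ, 0 < ρ → ρ < ρ₁ → ∀ᶠ N : ℕ in atTop,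
      ∃ M : ℕ, 0 < M ∧ 2 * b * M < sideLength ρ N ∧
        ∀ Z ∈ {X : Config N | ∀ i j : Fin N, i ≠ j → ∀ n : Fin 3 → ℤ, b < ‖X i - X j - latticeVec (sideLength ρ N) n‖},
          (∀ Y : Config N,
            JoinedIn {X : Config N | ∀ i j : Fin N, i ≠ j → ∀ n : Fin 3 → ℤ,
              b < ‖X i - X j - latticeVec (sideLength ρ N) n‖} Z Y →
            ∀ d : ℝ, (∀ i j : Fin N, i ≠ j → ∀ n : Fin 3 → ℤ, d ≤ ‖Y i - Y j - latticeVec (sideLength ρ N) n‖) →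
              ∀ i j : Fin N, i ≠ j → ∀ n : Fin 3 → ℤ, d ≤ ‖Z i - Z j - latticeVec (sideLength ρ N) n‖) →
          ∀ i j : Fin N, i ≠ j → ∀ n : Fin 3 → ℤ,
            4 * (sideLength ρ N / M) ≤ ‖Z i - Z j - latticeVec (sideLength ρ N) n‖) →
    ∀ b : ℝ, 0 < b → ∃ ρ₁ : ℝ, 0 < ρ₁ ∧ ∀ ρ : ℝ, 0 < ρ → ρ < ρ₁ → ∀ᶠ N : ℕ in atTop,
      ∀ X ∈ {X : Config N | ∀ i j : Fin N, i ≠ j → ∀ n : Fin 3 → ℤ, b < ‖X i - X j - latticeVec (sideLength ρ N) n‖},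
        ∀ Y ∈ {X : Config N | ∀ i j : Fin N, i ≠ j → ∀ n : Fin 3 → ℤ, b < ‖X i - X j - latticeVec (sideLength ρ N) n‖},
          ∃ σ : Equiv.Perm (Fin N),
            JoinedIn {X : Config N | ∀ i j : Fin N, i ≠ j → ∀ n : Fin 3 → ℤ,
              b < ‖X i - X j - latticeVec (sideLength ρ N) n‖} X (Y ∘ σ) := by
  intro hA hD1 hD2 hFloor b hb
  obtain ⟨ρ₁, hρ₁, hρ⟩ := hFloor b hb
  refine ⟨ρ₁, hρ₁, fun ρ hρ0 hρlt => ?_⟩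
  filter_upwards [hρ ρ hρ0 hρlt, (tendsto_sideLength_atTop hρ0).eventually_gt_atTop 0] with N hN hL
  obtain ⟨M, hM, hbM, hfl⟩ := hN
  intro X hX Y hY
  -- maximisers of the minimal image pair distance over the components of `X` and `Y`
  obtain ⟨ZX, hZX, hXZ, hmaxX⟩ := hA N (sideLength ρ N) b hL X hX
  obtain ⟨ZY, hZY, hYZ, hmaxY⟩ := hA N (sideLength ρ N) b hL Y hY
  -- they are maximal over their own components, so the floor applies
  have hflX := hfl ZX hZX fun Y' hY' d hd => hmaxX Y' (hXZ.trans hY') d hd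
  have hflY := hfl ZY hZY fun Y' hY' d hd => hmaxY Y' (hYZ.trans hY') d hd
  -- lattice retraction and lattice matching
  obtain ⟨TX, hTXlat, hTXsep, hZTX⟩ := hD1 N M (sideLength ρ N) b hM hb hbM ZX hflX
  obtain ⟨TY, hTYlat, hTYsep, hZTY⟩ := hD1 N M (sideLength ρ N) b hM hb hbM ZY hflY
  obtain ⟨σ, hσ⟩ := hD2 N M (sideLength ρ N) b hM hb hbM TX TY hTXlat hTXsep hTYlat hTYsep
  -- chain, relabelling the path `Y ~ Z_Y ~ T_Y` by `σ`
  exact ⟨σ, (hXZ.trans (hZTX.trans hσ)).trans (LemmaGFloor.joinedIn_comp_perm σ (hYZ.trans hZTY)).symm⟩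

/-- **The dilute hard-sphere connectivity statement G from the sparse-maximiser floor alone** (crux
`GridInfDivCoherence`, line `registered`): `lemmaGConnected_of_maximiserFloor` with the component maximiser (A), the
lattice retraction (D1) and the lattice matching (D2) discharged by the landed sub-goals
`freeRegion_exists_joined_maximiser`, `freeRegion_joined_latticeConfig`, `freeRegion_latticeConfigs_joined`.
[folklore] -/
theorem lemmaGConnected_of_maximiserFloor'
    (hFloor : ∀ b : ℝ, 0 < b → ∃ ρ₁ : ℝ, 0 < ρ₁ ∧ ∀ ρ : ℝ, 0 < ρ → ρ < ρ₁ → ∀ᶠ N : ℕ in atTop,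
      ∃ M : ℕ, 0 < M ∧ 2 * b * M < sideLength ρ N ∧
        ∀ Z ∈ {X : Config N | ∀ i j : Fin N, i ≠ j → ∀ n : Fin 3 → ℤ, b < ‖X i - X j - latticeVec (sideLength ρ N) n‖},
          (∀ Y : Config N,
            JoinedIn {X : Config N | ∀ i j : Fin N, i ≠ j → ∀ n : Fin 3 → ℤ,
              b < ‖X i - X j - latticeVec (sideLength ρ N) n‖} Z Y →
            ∀ d : ℝ, (∀ i j : Fin N, i ≠ j → ∀ n : Fin 3 → ℤ, d ≤ ‖Y i - Y j - latticeVec (sideLength ρ N) n‖) →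
              ∀ i j : Fin N, i ≠ j → ∀ n : Fin 3 → ℤ, d ≤ ‖Z i - Z j - latticeVec (sideLength ρ N) n‖) →
          ∀ i j : Fin N, i ≠ j → ∀ n : Fin 3 → ℤ,
            4 * (sideLength ρ N / M) ≤ ‖Z i - Z j - latticeVec (sideLength ρ N) n‖) :
    ∀ b : ℝ, 0 < b → ∃ ρ₁ : ℝ, 0 < ρ₁ ∧ ∀ ρ : ℝ, 0 < ρ → ρ < ρ₁ → ∀ᶠ N : ℕ in atTop,
      ∀ X ∈ {X : Config N | ∀ i j : Fin N, i ≠ j → ∀ n : Fin 3 → ℤ, b < ‖X i - X j - latticeVec (sideLength ρ N) n‖},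
        ∀ Y ∈ {X : Config N | ∀ i j : Fin N, i ≠ j → ∀ n : Fin 3 → ℤ, b < ‖X i - X j - latticeVec (sideLength ρ N) n‖},
          ∃ σ : Equiv.Perm (Fin N),
            JoinedIn {X : Config N | ∀ i j : Fin N, i ≠ j → ∀ n : Fin 3 → ℤ,
              b < ‖X i - X j - latticeVec (sideLength ρ N) n‖} X (Y ∘ σ) :=
  lemmaGConnected_of_maximiserFloor freeRegion_exists_joined_maximiser freeRegion_joined_latticeConfig
    freeRegion_latticeConfigs_joined hFloor

end Summit.AtomisticToContinuum.BoseEinsteinCondensation.Theorems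

end
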